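import Summits.CriticalPhenomena.PercolationContinuityZ3.Theorems.PercNearOneGluingNoHeavyLowerTailKNGoodGMgcCellTools
import HarnessLib

/-!
# Side cells: THEOREM B's contracted observer `o* = [xy]` at a deterministic side configuration
# (`NoHeavyLowerTail` cell, stmt-CriticalPhenomena-4575; prover `prim-hp-2`, gen 19 — brick L5a of the semantic layer,
# memo `run/shared/lean/prim/prim-hp-2/MEMO-gen17-lean-certificates.md` §4')

Support file (`--supports stmt-CriticalPhenomena-4575`; imports the COMPUTATIONAL `…KNGoodGMgcSideGlue`).  Small computable
definitions (`pick`, `cplus`, `Verts.relay`, `Verts.U`) + the almost-sure bookkeeping of one deterministic side; no named facts, no sorries.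
Setting: frame `V : Verts n`, pendant `u`, the contraction `K/{x,y}` realised as `u' = u[s(x,y) ↦ 1]` with observer `x`; by
`…SideDecomp.real_eq_bexpR_force` every `u'`-probability is a Bernoulli expectation over the eleven remaining side bits of
probabilities under the DETERMINISTIC sides `G_c := force u e 12 (cplus c)` (`cplus c` = `c` with bit `11` (the pair `xy`) set).
This file evaluates, at every `c`:
* (generic a.s. tools are in `…KNGoodGMgcCellTools`);
* `pick c` — a relay surely joined to `x` in `G_c` (priority: hairs of `x`, hairs of `y`, hairs of `z` when a `z`-pair is open; `0` = none);
  **`Verts.real_x_joined`** (`pick c ≠ 0`: a.s. `x ↔ relay (pick c)`), **`Verts.real_x_eq_zero`** / **`Verts.real_clusterIs_U`** (`pick c = 0`: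
  `μ_{G_c}(x ↔ b) = 0` and the cluster of `x` is a.s. `U c` = `{x,y}` or `{x,y,z}`), `Verts.real_clusterIs_null_of_pick`
  (`pick c ≠ 0`: every null pocket has probability `0`), `Verts.real_relay_cell` (relay reliabilities = glued-core reliabilities of the world
  `sideWorld (cplus c)`, from `real_openConn_force_side`);
* the residual graphs of the two pockets: `Verts.real_openConnIn_xyz` (`μ_{u'}(a ↔ b off {x,y,z}) = μ_{core u}(a ↔ b)`) and
  `Verts.restrW_xy_pendant` / `Verts.real_glued_restrW_xy` (the graph `C + z` = `restrW {x,y}ᶜ u'` is again a pendant side over the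
  same core, with the same glued-core reliabilities).
The sequel `…KNGoodGMgcTarget.lean` sums these cells into `Φ(K/B, o*; j) = Σ_v phiCoef j r v X · v`.
-/

noncomputable section

namespace Summit.CriticalPhenomena.PercolationContinuityZ3.Theorems

namespace KNGoodGMgc

open MeasureTheory Set Literature.Probability.LatticeModels Literature.Probability.Percolation KNGoodAux
open scoped Classical

variable {n : ℕ}

/-! ## The deterministic sides of `u' = u[xy ↦ 1]` -/

/-- The configuration `c` with bit `11` (the pair `xy`) set. [this work] -/
def cplus (c : Cfg) : Cfg := Function.update c 11 true

/-- `cplus` does not change the bits below `11`. [this work] -/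
theorem cplus_apply_of_lt (c : Cfg) (k : ℕ) (hk : k < 11) : cplus c k = c k := by
  simp [cplus, Function.update_of_ne (Nat.ne_of_lt hk)]

/-- Bit `11` of `cplus c` is set. [this work] -/
@[simp] theorem cplus_eleven (c : Cfg) : cplus c 11 = true := by simp [cplus]

/-- The relay (index `1,2,3`) surely joined to `x` at the configuration `c`, found in the priority order: hairs of `x`, hairs of `y`,
hairs of `z` when a `z`-pair is open; `0` if there is none. [this work] -/
def pick (c : Cfg) : ℕ :=
  if c 0 then 1 else if c 1 then 2 else if c 2 then 3 else if c 3 then 1 else if c 4 then 2 else if c 5 then 3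
  else if c 9 || c 10 then (if c 6 then 1 else if c 7 then 2 else if c 8 then 3 else 0) else 0

/-- When no relay is picked, all hairs of `x` and `y` are absent, and either both `z`-pairs are closed or all hairs of `z` are
absent too. [this work] -/
theorem bits_of_pick_eq_zero (c : Cfg) (h : pick c = 0) :
    c 0 = false ∧ c 1 = false ∧ c 2 = false ∧ c 3 = false ∧ c 4 = false ∧ c 5 = false ∧
      ((c 9 = false ∧ c 10 = false) ∨ (c 6 = false ∧ c 7 = false ∧ c 8 = false)) := by
  unfold pick at h
  cases h0 : c 0 <;> cases h1 : c 1 <;> cases h2 : c 2 <;> cases h3 : c 3 <;> cases h4 : c 4 <;> cases h5 : c 5 <;>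
    cases h6 : c 6 <;> cases h7 : c 7 <;> cases h8 : c 8 <;> cases h9 : c 9 <;> cases h10 : c 10 <;>
    simp_all

namespace Verts

variable (V : Verts n)

/-- The relay with index `i` (`1 ↦ a₁`, `2 ↦ a₂`, anything else `↦ a₃`). [this work] -/
def relay (i : ℕ) : Fin n := if i = 1 then V.a₁ else if i = 2 then V.a₂ else V.a₃

/-- `relay 1 = a₁`. [this work] -/ @[simp] theorem relay_one : V.relay 1 = V.a₁ := rfl
/-- `relay 2 = a₂`. [this work] -/ @[simp] theorem relay_two : V.relay 2 = V.a₂ := rfl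
/-- `relay 3 = a₃`. [this work] -/ @[simp] theorem relay_three : V.relay 3 = V.a₃ := rfl

/-- Relays are off `{x,y,z}`. [this work] -/
theorem relay_not_mem (i : ℕ) : V.relay i ∉ ({V.x, V.y, V.z} : Finset (Fin n)) := by
  unfold relay
  split_ifs
  · exact V.a₁_not_mem
  · exact V.a₂_not_mem
  · exact V.a₃_not_mem

/-- Relays are relays. [this work] -/
theorem relay_mem (i : ℕ) : V.relay i ∈ ({V.a₁, V.a₂, V.a₃} : Finset (Fin n)) := by
  unfold relay; split_ifs <;> simp

/-- **Forcing the eleven remaining side edges of `u' = u[xy ↦ 1]` is forcing all twelve side edges of `u` at `cplus c`.** [this work] -/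
theorem force_update_eq (u : Sym2 (Fin n) → unitInterval) (c : Cfg) :
    force (Function.update u (V.e 11) 1) V.e 11 c = force u V.e 12 (cplus c) := by
  have hne : ∀ k, k < 11 → V.e k ≠ V.e 11 := fun k hk => V.e_inj k 11 (by omega) (by norm_num) (Nat.ne_of_lt hk)
  rw [force_update V.e 11 u c (V.e 11) 1 hne]
  show _ = Function.update (force u V.e 11 (cplus c)) (V.e 11) (if cplus c 11 then 1 else 0)
  rw [cplus_eleven, if_pos rfl, force_congr u V.e 11 (cplus c) c (fun k hk => cplus_apply_of_lt c k hk)]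

/-- A side edge whose bit is set in `cplus c` is sure in the deterministic side. [this work] -/
theorem force_cplus_e (u : Sym2 (Fin n) → unitInterval) (c : Cfg) (k : ℕ) (hk : k < 12) (h : cplus c k = true) :
    force u V.e 12 (cplus c) (V.e k) = 1 := by
  rw [force_apply_self u V.e 12 V.e_inj (cplus c) k hk, if_pos h]

/-- Values of the deterministic side off the open side edges: the core. [this work] -/
theorem force_cplus_apply_of_not {u : Sym2 (Fin n) → unitInterval} (hP : V.Pendant u) (c : Cfg) (f : Sym2 (Fin n))
    (hne : ∀ k, k < 12 → cplus c k = true → V.e k ≠ f) : force u V.e 12 (cplus c) f = V.core u f := by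
  rw [V.force_side_eq hP (cplus c)]
  simp only
  rw [if_neg]
  intro hmem
  obtain ⟨k, hk, hck, hke⟩ := (V.mem_cimg_openAbs (cplus c) f).1 hmem
  exact hne k hk hck hke

section det

variable {u : Sym2 (Fin n) → unitInterval} (hP : V.Pendant u) (c : Cfg)
include hP

/-- A pair at `x,y,z` that is no OPEN side edge has weight `0` in the deterministic side. [this work] -/
theorem force_cplus_eq_zero (f : Sym2 (Fin n)) (hf : ∃ v ∈ ({V.x, V.y, V.z} : Finset (Fin n)), v ∈ f)
    (hne : ∀ k, k < 12 → cplus c k = true → V.e k ≠ f) : force u V.e 12 (cplus c) f = 0 := by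
  rw [V.force_cplus_apply_of_not hP c f hne, V.core_eq_zero u f hf]

omit hP in
/-- a.s. join along one sure side edge. [this work] -/
theorem joined_e (k : ℕ) (hk : k < 12) (h : cplus c k = true) (p q : Fin n) (hpq : p ≠ q) (he : V.e k = s(p, q)) :
    (prodBernoulli (force u V.e 12 (cplus c))).real (openConn p q)ᶜ = 0 :=
  UpsetExchange.real_not_openConn_eq_zero_of_surePair _ p q hpq (by rw [← he]; exact V.force_cplus_e u c k hk h)

omit hP in
/-- **A picked relay is almost surely joined to `x`.** [this work] -/
theorem real_x_joined (h : pick c ≠ 0) :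
    (prodBernoulli (force u V.e 12 (cplus c))).real (openConn V.x (V.relay (pick c)))ᶜ = 0 := by
  have J := V.joined_e (u := u) c
  have T := real_compl_openConn_eq_zero_trans (force u V.e 12 (cplus c))
  have hb : ∀ k, k < 11 → c k = true → cplus c k = true := fun k hk hc => by rw [cplus_apply_of_lt c k hk]; exact hc
  have hxy : (prodBernoulli (force u V.e 12 (cplus c))).real (openConn V.x V.y)ᶜ = 0 :=
    J 11 (by norm_num) (cplus_eleven c) V.x V.y V.hxy (V.e_11)
  unfold pick at h ⊢
  by_cases h0 : c 0 = true
  · simp only [h0, if_true]; exact J 0 (by norm_num) (hb 0 (by norm_num) h0) _ _ V.hxa₁ (V.e_0)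
  simp only [h0] at h ⊢
  by_cases h1 : c 1 = true
  · simp only [h1, if_true]; exact J 1 (by norm_num) (hb 1 (by norm_num) h1) _ _ V.hxa₂ (V.e_1)
  simp only [h1] at h ⊢
  by_cases h2 : c 2 = true
  · simp only [h2, if_true]; exact J 2 (by norm_num) (hb 2 (by norm_num) h2) _ _ V.hxa₃ (V.e_2)
  simp only [h2] at h ⊢
  by_cases h3 : c 3 = true
  · simp only [h3, if_true]; exact T _ _ _ hxy (J 3 (by norm_num) (hb 3 (by norm_num) h3) _ _ V.hya₁ (V.e_3))
  simp only [h3] at h ⊢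
  by_cases h4 : c 4 = true
  · simp only [h4, if_true]; exact T _ _ _ hxy (J 4 (by norm_num) (hb 4 (by norm_num) h4) _ _ V.hya₂ (V.e_4))
  simp only [h4] at h ⊢
  by_cases h5 : c 5 = true
  · simp only [h5, if_true]; exact T _ _ _ hxy (J 5 (by norm_num) (hb 5 (by norm_num) h5) _ _ V.hya₃ (V.e_5))
  simp only [h5] at h ⊢
  by_cases h910 : (c 9 || c 10) = true
  · simp only [h910, if_true] at h ⊢
    -- `x` is a.s. joined to `z`
    have hxz : (prodBernoulli (force u V.e 12 (cplus c))).real (openConn V.x V.z)ᶜ = 0 := by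
      rcases Bool.or_eq_true_iff.1 h910 with h9 | h10
      · exact T _ _ _ hxy (J 9 (by norm_num) (hb 9 (by norm_num) h9) _ _ V.hyz (V.e_9))
      · exact J 10 (by norm_num) (hb 10 (by norm_num) h10) _ _ V.hxz (V.e_10)
    by_cases h6 : c 6 = true
    · simp only [h6, if_true]; exact T _ _ _ hxz (J 6 (by norm_num) (hb 6 (by norm_num) h6) _ _ V.hza₁ (V.e_6))
    simp only [h6] at h ⊢
    by_cases h7 : c 7 = true
    · simp only [h7, if_true]; exact T _ _ _ hxz (J 7 (by norm_num) (hb 7 (by norm_num) h7) _ _ V.hza₂ (V.e_7))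
    simp only [h7] at h ⊢
    by_cases h8 : c 8 = true
    · simp only [h8, if_true]; exact T _ _ _ hxz (J 8 (by norm_num) (hb 8 (by norm_num) h8) _ _ V.hza₃ (V.e_8))
    simp only [h8] at h
    exact absurd rfl h
  · simp only [h910] at h
    exact absurd rfl h

/-- The side cluster when no relay is picked: `{x,y,z}` if a `z`-pair is open, else `{x,y}`. [this work] -/
def U (c : Cfg) : Finset (Fin n) := if (c 9 || c 10) = true then {V.x, V.y, V.z} else {V.x, V.y}

omit hP in
/-- `U c ⊆ {x,y,z}`. [this work] -/
theorem U_subset : V.U c ⊆ ({V.x, V.y, V.z} : Finset (Fin n)) := by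
  unfold U; split_ifs
  · exact Finset.Subset.refl _
  · intro v hv; simp only [Finset.mem_insert, Finset.mem_singleton] at hv ⊢; tauto

omit hP in
/-- `x ∈ U c`. [this work] -/
theorem x_mem_U : V.x ∈ V.U c := by unfold U; split_ifs <;> simp

omit hP in
/-- `U c` misses the relays. [this work] -/
theorem U_mem_nullSets : V.U c ∈ nullSets ({V.a₁, V.a₂, V.a₃} : Finset (Fin n)) := by
  rw [mem_nullSets, Finset.disjoint_left]
  intro v hv hvA
  have hv' := V.U_subset c hv
  simp only [Finset.mem_insert, Finset.mem_singleton] at hv' hvA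
  have := V.hxa₁; have := V.hxa₂; have := V.hxa₃; have := V.hya₁; have := V.hya₂; have := V.hya₃
  have := V.hza₁; have := V.hza₂; have := V.hza₃
  rcases hv' with rfl | rfl | rfl <;> rcases hvA with h | h | h <;> simp_all

/-- **The boundary of `U c` has weight `0` when no relay is picked.** [this work] -/
theorem U_cut (h : pick c = 0) : ∀ p ∈ V.U c, ∀ t : Fin n, t ∉ V.U c → force u V.e 12 (cplus c) s(p, t) = 0 := by
  obtain ⟨h0, h1, h2, h3, h4, h5, hrest⟩ := bits_of_pick_eq_zero c h
  intro p hp t ht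
  have hp3 := V.U_subset c hp
  refine V.force_cplus_eq_zero hP c _ ⟨p, hp3, Sym2.mem_mk_left _ _⟩ ?_
  intro k hk hck hke
  have htmem : t ∈ V.e k := by rw [hke]; exact Sym2.mem_mk_right _ _
  have hpmem : p ∈ V.e k := by rw [hke]; exact Sym2.mem_mk_left _ _
  have hxU : V.x ∈ V.U c := V.x_mem_U c
  have hyU : V.y ∈ V.U c := by unfold U; split_ifs <;> simp
  simp only [Finset.mem_insert, Finset.mem_singleton] at hp3
  have hX := V.hxz; have hY := V.hyz; have := V.hxa₁; have := V.hxa₂; have := V.hxa₃; have := V.hya₁; have := V.hya₂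
  have := V.hya₃; have := V.hza₁; have := V.hza₂; have := V.hza₃
  interval_cases k
  · rw [cplus_apply_of_lt c 0 (by norm_num)] at hck; simp_all
  · rw [cplus_apply_of_lt c 1 (by norm_num)] at hck; simp_all
  · rw [cplus_apply_of_lt c 2 (by norm_num)] at hck; simp_all
  · rw [cplus_apply_of_lt c 3 (by norm_num)] at hck; simp_all
  · rw [cplus_apply_of_lt c 4 (by norm_num)] at hck; simp_all
  · rw [cplus_apply_of_lt c 5 (by norm_num)] at hck; simp_all
  · -- k = 6: `s(z, a₁)`; needs the `z`-pairs open (else bit 6 is off), then `z ∈ U`, and `t = a₁`… but `p ∈ {x,y,z}` must be `z`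
    rw [cplus_apply_of_lt c 6 (by norm_num)] at hck
    rw [V.e_6] at hpmem htmem
    rcases hrest with ⟨h9, h10⟩ | ⟨h6, -, -⟩
    · have hzU : V.z ∉ V.U c := by unfold U; simp [h9, h10, V.hxz.symm, V.hyz.symm]
      rcases Sym2.mem_iff.1 hpmem with hp' | hp'
      · exact hzU (hp' ▸ hp)
      · rcases hp3 with rfl | rfl | rfl <;> simp_all
    · simp_all
  · rw [cplus_apply_of_lt c 7 (by norm_num)] at hck
    rw [V.e_7] at hpmem htmem
    rcases hrest with ⟨h9, h10⟩ | ⟨-, h7, -⟩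
    · have hzU : V.z ∉ V.U c := by unfold U; simp [h9, h10, V.hxz.symm, V.hyz.symm]
      rcases Sym2.mem_iff.1 hpmem with hp' | hp'
      · exact hzU (hp' ▸ hp)
      · rcases hp3 with rfl | rfl | rfl <;> simp_all
    · simp_all
  · rw [cplus_apply_of_lt c 8 (by norm_num)] at hck
    rw [V.e_8] at hpmem htmem
    rcases hrest with ⟨h9, h10⟩ | ⟨-, -, h8⟩
    · have hzU : V.z ∉ V.U c := by unfold U; simp [h9, h10, V.hxz.symm, V.hyz.symm]
      rcases Sym2.mem_iff.1 hpmem with hp' | hp'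
      · exact hzU (hp' ▸ hp)
      · rcases hp3 with rfl | rfl | rfl <;> simp_all
    · simp_all
  · -- k = 9: `s(y,z)` open ⇒ `z ∈ U`, so `t ∈ {y,z} ⊆ U`
    rw [cplus_apply_of_lt c 9 (by norm_num)] at hck
    have hzU : V.z ∈ V.U c := by unfold U; simp [hck]
    rw [V.e_9] at htmem
    rcases Sym2.mem_iff.1 htmem with rfl | rfl
    · exact ht hyU
    · exact ht hzU
  · rw [cplus_apply_of_lt c 10 (by norm_num)] at hck
    have hzU : V.z ∈ V.U c := by unfold U; simp [hck]
    rw [V.e_10] at htmem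
    rcases Sym2.mem_iff.1 htmem with rfl | rfl
    · exact ht hxU
    · exact ht hzU
  · rw [V.e_11] at htmem
    rcases Sym2.mem_iff.1 htmem with rfl | rfl
    · exact ht hxU
    · exact ht hyU

/-- **No relay picked ⇒ `x` is joined to nothing outside `U c`**, in particular not to `b ∉ {x,y,z}`. [this work] -/
theorem real_x_eq_zero (h : pick c = 0) (t : Fin n) (ht : t ∉ ({V.x, V.y, V.z} : Finset (Fin n))) :
    (prodBernoulli (force u V.e 12 (cplus c))).real (openConn V.x t) = 0 :=
  real_openConn_eq_zero_of_cut _ (V.U c) V.x t (V.x_mem_U c) (fun h' => ht (V.U_subset c h')) (V.U_cut hP c h)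

/-- **No relay picked ⇒ the cluster of `x` is almost surely `U c`.** [this work] -/
theorem real_clusterIs_U (h : pick c = 0) : (prodBernoulli (force u V.e 12 (cplus c))).real (clusterIs V.x (V.U c)) = 1 := by
  refine real_clusterIs_eq_one _ (V.U c) V.x (V.x_mem_U c) (V.U_cut hP c h) fun v hv => ?_
  haveI : IsProbabilityMeasure (prodBernoulli (force u V.e 12 (cplus c))) := inferInstance
  have hxy : (prodBernoulli (force u V.e 12 (cplus c))).real (openConn V.x V.y)ᶜ = 0 :=
    V.joined_e c 11 (by norm_num) (cplus_eleven c) V.x V.y V.hxy (V.e_11)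
  unfold U at hv
  split_ifs at hv with h910
  · simp only [Finset.mem_insert, Finset.mem_singleton] at hv
    rcases hv with rfl | rfl | rfl
    · rw [show ((openConn V.x V.x)ᶜ : Set (BondConfig (Fin n))) = ∅ from ?_, measureReal_empty]
      ext ω; simp only [mem_compl_iff, mem_empty_iff_false, iff_false, not_not]
      exact SimpleGraph.Reachable.refl _
    · exact hxy
    · rcases Bool.or_eq_true_iff.1 h910 with h9 | h10
      · exact real_compl_openConn_eq_zero_trans _ _ _ _ hxy
          (V.joined_e c 9 (by norm_num) (by rw [cplus_apply_of_lt c 9 (by norm_num)]; exact h9) V.y V.z V.hyz (V.e_9))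
      · exact V.joined_e c 10 (by norm_num) (by rw [cplus_apply_of_lt c 10 (by norm_num)]; exact h10) V.x V.z V.hxz (V.e_10)
  · simp only [Finset.mem_insert, Finset.mem_singleton] at hv
    rcases hv with rfl | rfl
    · rw [show ((openConn V.x V.x)ᶜ : Set (BondConfig (Fin n))) = ∅ from ?_, measureReal_empty]
      ext ω; simp only [mem_compl_iff, mem_empty_iff_false, iff_false, not_not]
      exact SimpleGraph.Reachable.refl _
    · exact hxy

omit hP in
/-- **A picked relay kills every null pocket.** [this work] -/
theorem real_clusterIs_null_of_pick (h : pick c ≠ 0) (W : Finset (Fin n))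
    (hW : W ∈ nullSets ({V.a₁, V.a₂, V.a₃} : Finset (Fin n))) :
    (prodBernoulli (force u V.e 12 (cplus c))).real (clusterIs V.x W) = 0 :=
  real_clusterIs_eq_zero_of_joined _ V.x (V.relay (pick c)) W
    (fun hm => Finset.disjoint_left.1 (mem_nullSets.1 hW) hm (V.relay_mem (pick c))) (V.real_x_joined c h)

/-- **Relay reliabilities in a deterministic side are glued-core reliabilities of its world.** [this work] -/
theorem real_relay_cell (b : Fin n) (hb : b ∉ ({V.x, V.y, V.z} : Finset (Fin n))) (a : Fin n)
    (ha : a ∉ ({V.x, V.y, V.z} : Finset (Fin n))) :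
    (prodBernoulli (force u V.e 12 (cplus c))).real (openConn a b) = V.rel u b (sideWorld (cplus c)) a :=
  V.real_openConn_force_side hP (cplus c) a b ha hb

end det

/-! ## The residual graphs of the two pockets -/

section residual

variable {u : Sym2 (Fin n) → unitInterval} (hP : V.Pendant u)
include hP

omit hP in
/-- The residual graph of the pocket `{x,y,z}` is the core: `μ_{u[xy↦1]}(a ↔ b off {x,y,z}) = μ_{core u}(a ↔ b)`. [this work] -/
theorem real_openConnIn_xyz (a b : Fin n) (ha : a ∉ ({V.x, V.y, V.z} : Finset (Fin n)))
    (hb : b ∉ ({V.x, V.y, V.z} : Finset (Fin n))) :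
    (prodBernoulli (Function.update u (V.e 11) 1)).real (openConnIn ((↑({V.x, V.y, V.z} : Finset (Fin n)) : Set (Fin n))ᶜ) a b) =
      (prodBernoulli (V.core u)).real (openConn a b) := by
  set S : Set (Fin n) := ((↑({V.x, V.y, V.z} : Finset (Fin n)) : Set (Fin n))ᶜ) with hS
  have haS : a ∈ S := fun h => ha (Finset.mem_coe.1 h)
  have hbS : b ∈ S := fun h => hb (Finset.mem_coe.1 h)
  have hw : restrW S (Function.update u (V.e 11) 1) = restrW S (V.core u) := by
    funext f
    unfold restrW
    split_ifs with hf
    · have hx : V.x ∉ f := fun h => (hf.1 V.x h) (by simp)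
      have hy : V.y ∉ f := fun h => (hf.1 V.y h) (by simp)
      have hz : V.z ∉ f := fun h => (hf.1 V.z h) (by simp)
      rw [V.core_eq_self u f hx hy hz, Function.update_of_ne]
      intro h; rw [h, V.e_11] at hx; exact hx (Sym2.mem_mk_left _ _)
    · rfl
  rw [real_openConnIn_eq_restrW _ S a b haS, hw, ← real_openConnIn_eq_restrW _ S a b haS]
  -- under the core, no open pair meets `{x,y,z}`, so `a ↔ b` iff `a ↔ b off {x,y,z}`
  refine real_eq_of_compl_null (V.core u) _ _ {ω : BondConfig (Fin n) | ∃ e ∈ ω, ∃ v ∈ ({V.x, V.y, V.z} : Finset (Fin n)), v ∈ e}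
    (real_exists_openAt_eq_zero (V.core u) {V.x, V.y, V.z} (fun f hf => V.core_eq_zero u f hf)) fun ω hω => ?_
  constructor
  · rintro ⟨_, _, hr⟩
    exact hr.map (SimpleGraph.Embedding.induce S).toHom
  · intro h
    refine openConnIn_of_reachable_of_forall_mem h fun y hy hyV => ?_
    obtain ⟨p⟩ := hy.symm
    cases p with
    | nil => exact ha (Finset.mem_coe.1 hyV)
    | cons hadj _ =>
      obtain ⟨hmem, -⟩ := (openGraph_adj ω _ _).1 hadj
      exact hω ⟨_, hmem, y, Finset.mem_coe.1 hyV, Sym2.mem_mk_left _ _⟩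

/-- The residual graph `C + z` of the pocket `{x,y}` (`restrW {x,y}ᶜ (u[xy↦1])`) is again a pendant side over the frame. [this work] -/
theorem restrW_xy_pendant :
    V.Pendant (restrW ((↑({V.x, V.y} : Finset (Fin n)) : Set (Fin n))ᶜ) (Function.update u (V.e 11) 1)) := by
  have hx : ∀ t, restrW ((↑({V.x, V.y} : Finset (Fin n)) : Set (Fin n))ᶜ) (Function.update u (V.e 11) 1) s(V.x, t) = 0 :=
    fun t => restrW_apply_of_not_mem _ (fun h => h.1 V.x (Sym2.mem_mk_left _ _) (by simp))
  have hy : ∀ t, restrW ((↑({V.x, V.y} : Finset (Fin n)) : Set (Fin n))ᶜ) (Function.update u (V.e 11) 1) s(V.y, t) = 0 :=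
    fun t => restrW_apply_of_not_mem _ (fun h => h.1 V.y (Sym2.mem_mk_left _ _) (by simp))
  refine ⟨fun t _ _ _ _ _ => hx t, fun t _ _ _ _ _ => hy t, fun t h1 h2 h3 h4 h5 => ?_⟩
  unfold restrW
  split_ifs with hf
  · rw [Function.update_of_ne]
    · exact hP.hz t h1 h2 h3 h4 h5
    · intro h
      have hz : V.z ∈ V.e 11 := h ▸ Sym2.mem_mk_left V.z t
      rw [V.e_11] at hz
      rcases Sym2.mem_iff.1 hz with h' | h'
      · exact V.hxz h'.symm
      · exact V.hyz h'.symm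
  · rfl

end residual

end Verts

end KNGoodGMgc

end Summit.CriticalPhenomena.PercolationContinuityZ3.Theorems

end
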